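import Literature.AlgebraicGeometry.HodgeTheory.ComplexifiedDeRhamFamily
import Literature.AlgebraicGeometry.Motives.GAGAKaehlerImmersionProofs
import HarnessLib

/-!
# Smooth projective complex varieties have Hodge models (proof file: discharge of the leaves)

Leaf companion (imported by no other file, so that heavy proof files can be gathered here) of
`HodgeModelExistenceProofs`, whose `nonempty_hodgeModel_of` reduces the named fact
`Literature.AlgebraicGeometry.HodgeTheory.nonempty_hodgeModel n X` of `HodgeModelExistence`
(every smooth projective, geometrically irreducible `X/ℂ` of dimension `n` has a Hodge model
`HodgeModel n X`: Serre's analytification `X^an` with de Rham's comparison and the Hodge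
decomposition) to three named facts of the tree:

* (3) de Rham's theorem with complex coefficients over the manifolds charted on `ℂⁿ`,
  `Literature.NumberTheory.Transcendental.exists_complexDeRhamIsoFamily (Fin n → ℂ)`
  (Wells (1980), Thm. III.4.13) — itself a consequence of the REAL de Rham theorem
  `Literature.NumberTheory.Transcendental.exists_deRhamIsoFamily 𝓘(ℝ, E)` (de Rham (1931);
  Warner (1983), Thm. 5.36) by complexification, PROVED in `ComplexifiedDeRhamFamily`
  (`exists_complexDeRhamIsoFamily_of_exists_deRhamIsoFamily`);
* (4a) analytifications of smooth projective varieties are Kähler,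
  `Literature.AlgebraicGeometry.Motives.isKaehlerManifold_of_isAnalytification_of_isClosedImmersion`
  (Voisin (2002), §3.3.2: restriction of the Fubini–Study metric) — now PROVED in the tree,
  `Literature.AlgebraicGeometry.Motives.isKaehlerManifold_of_isAnalytification_of_isClosedImmersion_holds`
  (`Motives/GAGAKaehlerImmersionProofs`);
* (4b) the Hodge decomposition of compact Kähler manifolds,
  `Literature.AlgebraicGeometry.Motives.isInternal_hodgePQ` (Voisin (2002), §6.1.3 Prop. 6.11) —
  a named fact without discharge at the time of writing (the harmonic theory it rests on is being
  assembled under `Transcendental/KaehlerHodge*`, `Transcendental/L2HodgeTheory*` and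
  `Motives/HodgeDecompositionProofs`).

This file feeds the discharged leaf (4a) into the assembly. PROVED here (no new named fact,
D-0026):

* `nonempty_hodgeModel_of_complexDeRham_of_hodgeDecomposition`: (3) ∧ (4b) ⟹
  `nonempty_hodgeModel n X`;
* `nonempty_hodgeModel_of_deRham_of_hodgeDecomposition`: (3ᵣ) the real de Rham theorem for the
  finite-dimensional complex model spaces ∧ (4b) ⟹ `nonempty_hodgeModel n X` for all `n`, `X`;
* `exists_isReal_hodgeModel_of_deRham_of_hodgeDecomposition`: the same two facts give the
  stronger REAL Hodge models of `ComplexConjugation` (`exists_isReal_hodgeModel`), through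
  `exists_isReal_hodgeModel_of_exists_deRhamIsoFamily` (`ComplexifiedDeRhamFamily`).

Hence the trust base of `nonempty_hodgeModel` (and of `exists_isReal_hodgeModel`) is now exactly
{de Rham's theorem, Hodge decomposition}; the closed discharge
`nonempty_hodgeModel_holds : nonempty_hodgeModel n X` is the one-liner
`nonempty_hodgeModel_of_deRham_of_hodgeDecomposition ‹3ᵣ› ‹4b› n X` (or the complex form) once
`exists_deRhamIsoFamily` (or `exists_complexDeRhamIsoFamily`) and `isInternal_hodgePQ` have their
`_holds` theorems, and belongs in this file.

Sources. Serre, GAGA §2: n°5 Lemme 1 and Prop. 2 (existence and uniqueness of `X^h`, Hausdorff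
by `(VA_II)`, "localement compact dénombrable à l'infini"), n°7 Prop. 6 (`X` complete ⟺ `X^h`
compact) — the analytification, proved upstream (`exists_compact_isAnalytification_of_isSmoothProjective`);
Voisin (2002), §3.3.2 Lemma 3.16 and p. 77 («every complex projective manifold is Kähler»),
§6.1.3 Prop. 6.11 (Hodge decomposition, `H^{p,q} = K^{p,q}`); Wells (1980), Thm. III.4.13 and
Warner (1983), Thm. 5.36 (de Rham).

## References

* J.-P. Serre, *Géométrie algébrique et géométrie analytique*, Ann. Inst. Fourier 6 (1956),
  1–42, §2 n°5 Prop. 2, n°7 Prop. 6. [SerreGAGA1956]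
* C. Voisin, *Hodge Theory and Complex Algebraic Geometry I* (2002), §3.3.2, §6.1.3 Prop. 6.11.
  [VoisinHodgeI2002]
* R. O. Wells, *Differential Analysis on Complex Manifolds* (1980), Thm. III.4.13. [WellsDACM1980]
* F. W. Warner, *Foundations of Differentiable Manifolds and Lie Groups* (1983), Thm. 5.36.
-/

noncomputable section

open scoped Manifold ContDiff

namespace Literature.AlgebraicGeometry.HodgeTheory

section HodgeTheory

variable {n : ℕ} {X : Motives.SchemeOver ℂ}

/-- **`nonempty_hodgeModel` from de Rham's theorem (complex coefficients, model `ℂⁿ`) and the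
Hodge decomposition.** With (4a) "smooth projective varieties are Kähler" now a theorem
(`isKaehlerManifold_of_isAnalytification_of_isClosedImmersion_holds`: the pulled-back Fubini–Study
form along the analytified closed immersion `X^an ↪ ℙᴺ(ℂ)` is a Kähler form), the assembly
`nonempty_hodgeModel_of` needs only (3) the natural complex de Rham isomorphism family over the
manifolds charted on `ℂⁿ` and (4b) the Hodge decomposition of compact Kähler manifolds.
[cite: SerreGAGA1956, §2 n°5 Prop. 2 and n°7 Prop. 6] [cite: WellsDACM1980, Thm. III.4.13]
[cite: VoisinHodgeI2002, §3.3.2 p. 77 and §6.1.3 Prop. 6.11] -/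
theorem nonempty_hodgeModel_of_complexDeRham_of_hodgeDecomposition
    (h3 : Literature.NumberTheory.Transcendental.exists_complexDeRhamIsoFamily (Fin n → ℂ))
    (h4b : ∀ (E : Type) [NormedAddCommGroup E] [NormedSpace ℂ E] [FiniteDimensional ℂ E]
      (M : Type) [TopologicalSpace M] [ChartedSpace E M] [IsManifold 𝓘(ℝ, E) ∞ M],
      Motives.isInternal_hodgePQ (E := E) (M := M)) :
    nonempty_hodgeModel n X :=
  nonempty_hodgeModel_of h3
    (fun _ _ _ _ _ _ _ _ ↦
      Motives.isKaehlerManifold_of_isAnalytification_of_isClosedImmersion_holds)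
    h4b

/-- **`nonempty_hodgeModel` from the REAL de Rham theorem and the Hodge decomposition.** If
(3ᵣ) de Rham's theorem `exists_deRhamIsoFamily 𝓘(ℝ, E)` (a natural, multiplicative, normalised
family `H^k_dR(M; ℝ) ≃ₗ[ℝ] Hᵏ(M; ℝ)`; de Rham (1931), Warner Thm. 5.36) holds for every
finite-dimensional complex model space `E` with its underlying real structure, and (4b) compact
Kähler manifolds have the Hodge decomposition (`isInternal_hodgePQ`, Voisin Prop. 6.11), then
every smooth projective `X/ℂ` of dimension `n` has a Hodge model: (3ᵣ) complexifies to the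
natural complex family (3) (`exists_complexDeRhamIsoFamily_of_exists_deRhamIsoFamily`, Voisin
§4.3.2 Rem. 4.48), and (4a) is the theorem
`isKaehlerManifold_of_isAnalytification_of_isClosedImmersion_holds`. The hypothesis (3ᵣ) is
quantified over all complex model spaces (rather than stated at `Fin n → ℂ`) so that the real
normed structure is the one underlying the complex one (`NormedSpace.complexToReal`), as in
`ComplexifiedDeRhamFamily`.
[cite: SerreGAGA1956, §2 n°5 Prop. 2 and n°7 Prop. 6] [cite: WarnerGTM94, Thm. 5.36]
[cite: VoisinHodgeI2002, §3.3.2 p. 77, §4.3.2 Rem. 4.48 and §6.1.3 Prop. 6.11] -/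
theorem nonempty_hodgeModel_of_deRham_of_hodgeDecomposition
    (h3 : ∀ (E : Type) [NormedAddCommGroup E] [NormedSpace ℂ E] [FiniteDimensional ℂ E],
      Literature.NumberTheory.Transcendental.exists_deRhamIsoFamily 𝓘(ℝ, E))
    (h4b : ∀ (E : Type) [NormedAddCommGroup E] [NormedSpace ℂ E] [FiniteDimensional ℂ E]
      (M : Type) [TopologicalSpace M] [ChartedSpace E M] [IsManifold 𝓘(ℝ, E) ∞ M],
      Motives.isInternal_hodgePQ (E := E) (M := M)) (n : ℕ) (X : Motives.SchemeOver ℂ) :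
    nonempty_hodgeModel n X :=
  nonempty_hodgeModel_of_exists_deRhamIsoFamily h3
    (fun _ _ _ _ _ _ _ _ _ _ ↦
      Motives.isKaehlerManifold_of_isAnalytification_of_isClosedImmersion_holds)
    h4b n X

/-- **Real Hodge models from the real de Rham theorem and the Hodge decomposition.** Under the
same two facts (3ᵣ), (4b), every smooth projective `X/ℂ` has a REAL Hodge model
(`exists_isReal_hodgeModel` of `ComplexConjugation`: the de Rham comparison intertwines the two
complex conjugations), by `exists_isReal_hodgeModel_of_exists_deRhamIsoFamily`
(`ComplexifiedDeRhamFamily`: the complexified family is real, Voisin Cor. 6.12) with (4a) the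
theorem `isKaehlerManifold_of_isAnalytification_of_isClosedImmersion_holds`.
[cite: SerreGAGA1956, §2 n°5 Prop. 2 and n°7 Prop. 6]
[cite: VoisinHodgeI2002, §3.3.2 p. 77, §4.3.2 Rem. 4.48, §6.1.3 Prop. 6.11 and Cor. 6.12] -/
theorem exists_isReal_hodgeModel_of_deRham_of_hodgeDecomposition
    (h3 : ∀ (E : Type) [NormedAddCommGroup E] [NormedSpace ℂ E] [FiniteDimensional ℂ E],
      Literature.NumberTheory.Transcendental.exists_deRhamIsoFamily 𝓘(ℝ, E))
    (h4b : ∀ (E : Type) [NormedAddCommGroup E] [NormedSpace ℂ E] [FiniteDimensional ℂ E]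
      (M : Type) [TopologicalSpace M] [ChartedSpace E M] [IsManifold 𝓘(ℝ, E) ∞ M],
      Motives.isInternal_hodgePQ (E := E) (M := M)) :
    exists_isReal_hodgeModel :=
  exists_isReal_hodgeModel_of_exists_deRhamIsoFamily h3
    (fun _ _ _ _ _ _ _ _ _ _ ↦
      Motives.isKaehlerManifold_of_isAnalytification_of_isClosedImmersion_holds)
    h4b


/-! ### The minimal de Rham input: a natural real family

The real de Rham fact `Literature.NumberTheory.Transcendental.exists_deRhamIsoFamily 𝓘(ℝ, E)` of
`Transcendental/DeRhamTheorem` bundles three clauses: naturality (Warner (1983), 5.36–5.38),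
multiplicativity wedge ↦ cup (Warner, Thm. 5.45; Bott–Tu (1982), Thm. 14.28) and the degree-`0`
normalisation `[1] ↦ 1`. A Hodge model consumes only a NATURAL complex family
(`HodgeModel.deRham_isNatural`), and the complexification `DeRhamIsoFamily.complexify` of
`ComplexifiedDeRhamFamily` is natural as soon as the real family is
(`DeRhamIsoFamily.complexify_isNatural`) and is real for every family
(`DeRhamIsoFamily.complexify_isReal`). The theorems of this section record the resulting weakest
requirement of `nonempty_hodgeModel` (and of `exists_isReal_hodgeModel`) on the de Rham side: the
existence, for the model `ℂⁿ` with its underlying real structure, of SOME natural real de Rham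
isomorphism family `H^k_dR(M; ℝ) ≃ₗ[ℝ] Hᵏ(M; ℝ)` over the Hausdorff σ-compact `C^∞` manifolds
charted on it — de Rham's theorem as a natural linear isomorphism (Warner, Thm. 5.36 with 5.38),
without the multiplicativity theorem 5.45. No new named fact is introduced (D-0026): the
hypothesis is the first two components of the existing fact `exists_deRhamIsoFamily`.
-/

/-- **A natural real de Rham isomorphism family complexifies to a natural complex one**: the
complex de Rham theorem `exists_complexDeRhamIsoFamily E` (Wells (1980), Thm. III.4.13) over the
manifolds charted on the finite-dimensional complex model space `E` follows from the existence of
a NATURAL real de Rham isomorphism family for `𝓘(ℝ, E)` alone — the multiplicativity and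
normalisation clauses of `exists_deRhamIsoFamily 𝓘(ℝ, E)` are not used
(`e ↦ e ⊗ ℂ`, `DeRhamIsoFamily.complexify`, natural by `DeRhamIsoFamily.complexify_isNatural`).
[cite: VoisinHodgeI2002, §4.3.2 Rem. 4.48] [cite: WarnerGTM94, Thm. 5.36 and 5.38] -/
theorem exists_complexDeRhamIsoFamily_of_exists_isNatural {E : Type} [NormedAddCommGroup E]
    [NormedSpace ℂ E] [FiniteDimensional ℂ E]
    (h : ∃ e : Literature.NumberTheory.Transcendental.DeRhamIsoFamily 𝓘(ℝ, E), e.IsNatural) :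
    Literature.NumberTheory.Transcendental.exists_complexDeRhamIsoFamily E := by
  obtain ⟨e, he⟩ := h
  exact ⟨e.complexify, Literature.NumberTheory.Transcendental.DeRhamIsoFamily.complexify_isNatural he⟩

/-- **… and to a natural and REAL complex family**: the real form
`exists_isReal_complexDeRhamIsoFamily E` of the complex de Rham theorem (`ComplexConjugationProofs`;
Voisin (2002), Thm. 4.47, Rem. 4.48, Cor. 6.12: "complex conjugation acts naturally on
`H^k(X, ℂ) = H^k(X, ℝ) ⊗ ℂ`") follows from a NATURAL real family alone, because the
complexification of every real family is real (`DeRhamIsoFamily.complexify_isReal`).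
[cite: VoisinHodgeI2002, §4.3.2 Rem. 4.48 and §6.1.3 Cor. 6.12] -/
theorem exists_isReal_complexDeRhamIsoFamily_of_exists_isNatural {E : Type} [NormedAddCommGroup E]
    [NormedSpace ℂ E] [FiniteDimensional ℂ E]
    (h : ∃ e : Literature.NumberTheory.Transcendental.DeRhamIsoFamily 𝓘(ℝ, E), e.IsNatural) :
    exists_isReal_complexDeRhamIsoFamily E := by
  obtain ⟨e, he⟩ := h
  exact ⟨e.complexify, Literature.NumberTheory.Transcendental.DeRhamIsoFamily.complexify_isNatural he,
    Literature.NumberTheory.Transcendental.DeRhamIsoFamily.complexify_isReal e⟩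

/-- **`nonempty_hodgeModel` from a NATURAL real de Rham isomorphism family and the Hodge
decomposition.** If (3ₙ) for every finite-dimensional complex model space `E`, with its
underlying real structure, there is a real de Rham isomorphism family over the Hausdorff
σ-compact `C^∞` manifolds charted on `E` that is natural for `C^∞` maps (de Rham (1931); Warner
(1983), Thm. 5.36 and 5.38 — the first two components of the tree's `exists_deRhamIsoFamily
𝓘(ℝ, E)`, its multiplicativity clause Thm. 5.45 being unnecessary here), and (4b) compact Kähler
manifolds have the Hodge decomposition (`isInternal_hodgePQ`; Voisin (2002), §6.1.3 Prop. 6.11),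
then every smooth projective, geometrically irreducible `X/ℂ` of dimension `n` has a Hodge model:
(3ₙ) at `E = ℂⁿ` complexifies to (3) (`exists_complexDeRhamIsoFamily_of_exists_isNatural`) and
the rest is `nonempty_hodgeModel_of_complexDeRham_of_hodgeDecomposition` (Serre's analytification,
compact and Hausdorff; Kähler by the analytified closed immersion into `ℙᴺ(ℂ)`). As in
`nonempty_hodgeModel_of_deRham_of_hodgeDecomposition`, (3ₙ) is quantified over all complex model
spaces so that the real normed structure of `ℂⁿ` is the one underlying its complex structure.
[cite: SerreGAGA1956, §2 n°5 Prop. 2 and n°7 Prop. 6] [cite: WarnerGTM94, Thm. 5.36 and 5.38]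
[cite: VoisinHodgeI2002, §3.3.2 p. 77, §4.3.2 Rem. 4.48 and §6.1.3 Prop. 6.11] -/
theorem nonempty_hodgeModel_of_isNatural_of_hodgeDecomposition
    (h3 : ∀ (E : Type) [NormedAddCommGroup E] [NormedSpace ℂ E] [FiniteDimensional ℂ E],
      ∃ e : Literature.NumberTheory.Transcendental.DeRhamIsoFamily 𝓘(ℝ, E), e.IsNatural)
    (h4b : ∀ (E : Type) [NormedAddCommGroup E] [NormedSpace ℂ E] [FiniteDimensional ℂ E]
      (M : Type) [TopologicalSpace M] [ChartedSpace E M] [IsManifold 𝓘(ℝ, E) ∞ M],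
      Motives.isInternal_hodgePQ (E := E) (M := M)) (n : ℕ) (X : Motives.SchemeOver ℂ) :
    nonempty_hodgeModel n X :=
  nonempty_hodgeModel_of_complexDeRham_of_hodgeDecomposition
    (exists_complexDeRhamIsoFamily_of_exists_isNatural (h3 (Fin n → ℂ))) h4b

/-- **Real Hodge models from a NATURAL real de Rham isomorphism family and the Hodge
decomposition**: under the same two hypotheses (3ₙ), (4b) every smooth projective `X/ℂ` has a
REAL Hodge model (`exists_isReal_hodgeModel` of `ComplexConjugation`), by
`exists_isReal_hodgeModel_of` fed with the complexified families
(`exists_isReal_complexDeRhamIsoFamily_of_exists_isNatural`: natural and real) and the theorem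
`isKaehlerManifold_of_isAnalytification_of_isClosedImmersion_holds` for (4a).
[cite: SerreGAGA1956, §2 n°5 Prop. 2 and n°7 Prop. 6]
[cite: VoisinHodgeI2002, §3.3.2 p. 77, §4.3.2 Rem. 4.48, §6.1.3 Prop. 6.11 and Cor. 6.12] -/
theorem exists_isReal_hodgeModel_of_isNatural_of_hodgeDecomposition
    (h3 : ∀ (E : Type) [NormedAddCommGroup E] [NormedSpace ℂ E] [FiniteDimensional ℂ E],
      ∃ e : Literature.NumberTheory.Transcendental.DeRhamIsoFamily 𝓘(ℝ, E), e.IsNatural)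
    (h4b : ∀ (E : Type) [NormedAddCommGroup E] [NormedSpace ℂ E] [FiniteDimensional ℂ E]
      (M : Type) [TopologicalSpace M] [ChartedSpace E M] [IsManifold 𝓘(ℝ, E) ∞ M],
      Motives.isInternal_hodgePQ (E := E) (M := M)) :
    exists_isReal_hodgeModel :=
  exists_isReal_hodgeModel_of
    (fun n ↦ exists_isReal_complexDeRhamIsoFamily_of_exists_isNatural (h3 (Fin n → ℂ)))
    (fun _ _ _ _ _ _ _ _ _ _ ↦
      Motives.isKaehlerManifold_of_isAnalytification_of_isClosedImmersion_holds)
    h4b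

/-- Sanity check in the other direction: the full real fact (3ᵣ) of the tree supplies (3ₙ), so
the natural-family assembly specialises to `nonempty_hodgeModel_of_deRham_of_hodgeDecomposition`'s
hypotheses. [cite: WarnerGTM94, Thm. 5.36] -/
theorem exists_isNatural_of_exists_deRhamIsoFamily {E : Type} [NormedAddCommGroup E]
    [NormedSpace ℂ E] [FiniteDimensional ℂ E]
    (h : Literature.NumberTheory.Transcendental.exists_deRhamIsoFamily 𝓘(ℝ, E)) :
    ∃ e : Literature.NumberTheory.Transcendental.DeRhamIsoFamily 𝓘(ℝ, E), e.IsNatural := by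
  obtain ⟨e, he, -, -⟩ := h
  exact ⟨e, he⟩

end HodgeTheory

end Literature.AlgebraicGeometry.HodgeTheory

end
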